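import Summits.NavierStokesRegularity.OSWSelfSimilar.SheetRTimeShiftModeWeak
import Summits.NavierStokesRegularity.OSWSelfSimilar.SheetREvansOdd
import Summits.NavierStokesRegularity.OSWSelfSimilar.SheetRLinearisationPerturbation
import HarnessLib

/-!
# SHEET-ℝ: (P6) of the Z3-SR-SPEC spectral certificate TRANSPORTED into the weak language of the S2 kernel assembly, part 2 —
# the time-shift mode `v = Ω* + ½ξΩ*′` as a weak image datum `IsWeakImage … (P, 0) (F′P − v)` and as selfsim's `IsWeakEigen … 1 u`,
# for the encoding `(drift a Ω*, potential L λ Ω*, −PopC* + F′)` and every bounded `F′`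

HONEST FRAMING (cell ns-blowup GROUP B / zone Z3, case Z3-SR-SPEC, P-list item (P6) as the HYPOTHESIS `(hv0 : v ≠ 0) (hv : IsWeakEigen hL K d V ℓ f θ 1 v)`
of `SheetRSpectrumOddAssembly.weakEigen_iff_eq_one` / `weakEigen_one_simple` / `weakEigen_set_eq_singleton` (selfsim g12) — here DISCHARGED for the data of
record up to the instantiation's rank-one bookkeeping; 1-D MODEL certificate frame (viscous gCLM/OSW sheet on the line, `ν = 1`); not Euler/NS; «violates:
none — MODEL»). Nothing here asserts that a profile exists: `Ω*` enters through the weak-zero hypotheses of record (cert-5 g5's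
`SheetRTimeShiftModeAssembly.timeShiftMode_eigen_and_energy_of_weakZero`) or through its strong consequences (`Ω* ∈ C³` + the pointwise identity).
CONTENT (part 1 = `SheetRTimeShiftModeWeak`: the integration by parts and the STRONG ⇒ WEAK identity).
* §4 `timeShiftMode_isWeakImage` — for a centre datum `hc : IsCentre L Ω Ω₁ H₀` with `Ω ∈ C³` and the strong equation there is `P ∈ Esp L hL`
  with `prim (der P) = v` and, for EVERY bounded `F′ : Esp →L L²_w`,
  `IsWeakImage hL (−PopC hL λ a hc + F′) (drift a Ω) (potential L λ Ω) (P, 0) (ofPair (F′P − ιE P, 0))` — i.e. `(DG(Ω) + F′)v = F′v − v` weakly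
  (`DG(Ω) = B_λ − P_Ω` in the encoding of `SheetRCertificateAssembly`); `P ≠ 0` as soon as `Ω(X₀) ≠ 0` (`timeShiftMode_ne_zero`);
  `timeShiftMode_isWeakImage_of_weakZero` feeds it from the weak-zero hypotheses of cert-5 g5's theorem (`ν = 1`, any `λ`).
* §5 `isWeakEigen_of_isWeakImage`, `timeShiftMode_isWeakEigen_of_weakZero` — the same, as selfsim's `SheetREvansOdd.IsWeakEigen … 1 u` for the
  complexified odd-class vector `u = ιE P + 0·i ∈ L²_{w,odd}(ℂ)` (`u ≠ 0`), for ALL rank-one data `(ℓ, f, θ)` COMPATIBLE with `F′` on `P`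
  (`(θ·ℓ u)·f = F′P + 0·i` — the instantiation's bookkeeping, e.g. `F′ = θ⟨h, ·⟩_w h`, `ℓ = ⟨h, ·⟩`, `f = h`), with `K := −PopC* + F′`,
  `d := drift a Ω*`, `V := potential L λ Ω*`. (The (S1) datum the assembly also needs, AT `Ω*`, is cert-5 g6's (P8)
  `SheetRLinearisationPerturbation.gardingDataKC_perturbedCentre` in the encoding `(d̄, V̄, K̄ + B_u)` at the centre; both encodings define the same
  weak form since `B_u = Qop u + (Qop)ᵀ u = DG(Ω̄ + u) − DG(Ω̄)`.)
No definition, no named fact, no `Prop` hypothesis beyond selfsim's structures. WHAT THIS IS NOT: not NS; not the spectral certificate; no number of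
record moves.
-/

noncomputable section

namespace Summit.NavierStokesRegularity.OSWSelfSimilar
namespace SheetRTimeShiftModeWeakEigen

open _root_.MeasureTheory _root_.Set _root_.Filter _root_.Real Literature.Analysis.Fourier SheetRWeakProfilePV SheetRWeakToStrong
  SheetREnergyClass SheetRWeightedMeasure SheetREnergySpace SheetRLinearisedTests SheetRTestSpace SheetRLinearisedFormBounds
  SheetRSolutionOperator SheetRComplexPivot SheetRAssemblyOperators SheetRCertificateAssembly SheetRGeneratorOddWeak
  SheetRLinearisationPerturbation SheetROddClass SheetRResolventOddClass SheetREvansOdd SheetRTimeShiftModeWeak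
open scoped Topology ENNReal ContDiff

variable {L : ℝ}

/-! ### §4 (P6) in the assembly's predicates: the time-shift mode as a weak image / weak eigenvector datum -/

/-- `Ω = ∫₀Ω₁` with `Ω ∈ C¹` forces `Ω₁ = Ω′` a.e. (Lebesgue differentiation). [folklore] -/
theorem ae_eq_deriv_of_isCentre (hL : 0 < L) {Ω Ω₁ : ℝ → ℝ} {H₀ : ℝ} (hc : IsCentre L Ω Ω₁ H₀) (hΩ : ContDiff ℝ 1 Ω) :
    Ω₁ =ᵐ[volume] deriv Ω := by
  obtain ⟨-, hΩ₁2, -, -, -⟩ := hc.basic hL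
  filter_upwards [_root_.LocallyIntegrable.ae_hasDerivAt_integral (hΩ₁2.locallyIntegrable one_le_two)] with y hy
  have e : Ω = fun x => ∫ s in (0 : ℝ)..x, Ω₁ s := funext hc.primitive
  have h1 : HasDerivAt Ω (Ω₁ y) y := by rw [e]; exact hy 0
  have h2 : HasDerivAt Ω (deriv Ω y) y := ((hΩ.differentiable one_ne_zero) y).hasDerivAt
  exact h1.unique h2

/-- **(P6) TRANSPORTED (strong data).** Let `hc : IsCentre L Ω Ω₁ H₀` be a centre datum with `Ω ∈ C³`, and let `v = Ω + ½ξΩ′` be odd with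
finite weights and satisfy the pointwise linearised equation with eigenvalue `−1` (the conclusions of cert-5 g5's
`timeShiftMode_eigen_and_energy(_of_weakZero)` at `ν = 1`). Then there is `P ∈ Esp L hL` with `prim (der P) = v`, `der P = v′` a.e., and
for EVERY bounded `F′ : Esp →L L²_w` the pair `(P, 0)` is a WEAK IMAGE datum
`IsWeakImage hL (−PopC hL λ a hc + F′) (drift a Ω) (potential L λ Ω) (P, 0) (ofPair (F′P − ιE P, 0))` — i.e. `(DG(Ω) + F′)v = F′v − v`
weakly, `DG(Ω) = B_λ − P_Ω` in the encoding of `SheetRCertificateAssembly`; with `F′ = θℓ(·)f` this is selfsim's `IsWeakEigen … 1`. MODEL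
statement; not NS. [folklore] -/
theorem timeShiftMode_isWeakImage (hL : 0 < L) (lam a : ℝ) {Ω Ω₁ : ℝ → ℝ} {H₀ : ℝ} (hc : IsCentre L Ω Ω₁ H₀)
    (hΩ : ContDiff ℝ 3 Ω) {v : ℝ → ℝ} (hv : v = fun ξ => Ω ξ + 1 / 2 * ξ * deriv Ω ξ) (hvodd : ∀ y, v (-y) = -v y)
    (hvw0 : Integrable fun y => (L ^ 2 + y ^ 2) * v y ^ 2) (hvw1 : Integrable fun y => (L ^ 2 + y ^ 2) * deriv v y ^ 2)
    (hstrong : ∀ X, v X + 1 / 2 * X * deriv v X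
        + a * ((∫ s in (0 : ℝ)..X, hilbertTransform v s) * deriv Ω X + (∫ s in (0 : ℝ)..X, hilbertTransform Ω s) * deriv v X)
        - hilbertTransform v X * Ω X - hilbertTransform Ω X * v X - iteratedDeriv 2 v X = -v X) :
    ∃ P : Esp L hL, prim (der P) = v ∧ (der P =ᵐ[volume] deriv v) ∧
      ∀ F' : Esp L hL →L[ℝ] W L,
        IsWeakImage hL (-PopC hL lam a hc + F') (drift a Ω) (potential L lam Ω)
          (WithLp.toLp 2 (P, (0 : Esp L hL))) (ofPair L (WithLp.toLp 2 (F' P - ιE hL P, (0 : W L)))) := by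
  -- regularity of `v`
  have hΩ2 : ContDiff ℝ 2 (deriv Ω) := (contDiff_succ_iff_deriv.1 hΩ).2.2
  have hv2 : ContDiff ℝ 2 v := by
    rw [hv]; exact (hΩ.of_le (by norm_num)).add ((contDiff_const.mul contDiff_id).mul hΩ2)
  have hv1 : ContDiff ℝ 1 v := hv2.of_le (by norm_num)
  have hv'c : Continuous (deriv v) := hv1.continuous_deriv le_rfl
  have hv0 : v 0 = 0 := by have := hvodd 0; rw [neg_zero] at this; linarith
  have hvprim : ∀ x, v x = ∫ s in (0 : ℝ)..x, deriv v s := fun x => by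
    rw [intervalIntegral.integral_deriv_eq_sub (fun y _ => (hv1.differentiable one_ne_zero) y)
      (hv'c.intervalIntegrable _ _), hv0, sub_zero]
  obtain ⟨P, hPv, hPd⟩ := exists_esp_of_profile hL hvprim hvodd hv'c.aestronglyMeasurable hvw0 hvw1
  obtain ⟨hdm, hVm, hd, hV⟩ := coef_bounds hL lam a hc
  have hΩ₁ := ae_eq_deriv_of_isCentre hL hc (hΩ.of_le (by norm_num))
  -- the `P`-term as `Pdata (PopC P)`
  have hPopfun : ∀ y, PopFun L lam a Ω Ω₁ P y =
      (lam * (L ^ 2 / (L ^ 2 + y ^ 2)) * v y + Ω y * hilbertTransform v y - a * Ω₁ y * ∫ s in (0 : ℝ)..y, hilbertTransform v s) := by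
    intro y; simp only [PopFun, hPv]
  have hPopae := PopC_apply hL lam a hc P
  have hPdata : ∀ {φ φ₁ : ℝ → ℝ} (hφ : IsCompactTest φ φ₁),
      ∫ y, (L ^ 2 + y ^ 2) * ((lam * (L ^ 2 / (L ^ 2 + y ^ 2)) * v y + Ω y * hilbertTransform v y
          - a * Ω₁ y * ∫ s in (0 : ℝ)..y, hilbertTransform v s) * φ y) = Pdata hL (PopC hL lam a hc P) ⟨(φ, φ₁), hφ⟩ := by
    intro φ φ₁ hφ
    rw [← integral_weight_mul_eq_Pdata hL (PopC hL lam a hc P) hφ]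
    refine integral_congr_ae ?_
    filter_upwards [hPopae] with y hy
    rw [hy, hPopfun y]
  have hPint : ∀ {φ φ₁ : ℝ → ℝ}, IsCompactTest φ φ₁ → Integrable fun y => (L ^ 2 + y ^ 2) *
      ((lam * (L ^ 2 / (L ^ 2 + y ^ 2)) * v y + Ω y * hilbertTransform v y
        - a * Ω₁ y * ∫ s in (0 : ℝ)..y, hilbertTransform v s) * φ y) := by
    intro φ φ₁ hφ
    refine (integrable_weight_mul_test hL (PopC hL lam a hc P) hφ).congr ?_
    filter_upwards [hPopae] with y hy
    rw [hy, hPopfun y]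
  -- the pivot term as `Pdata (ιE P)`
  have hιdata : ∀ {φ φ₁ : ℝ → ℝ} (hφ : IsCompactTest φ φ₁),
      ∫ y, (L ^ 2 + y ^ 2) * (v y * φ y) = Pdata hL (ιE hL P) ⟨(φ, φ₁), hφ⟩ := by
    intro φ φ₁ hφ
    rw [← integral_weight_mul_eq_Pdata hL (ιE hL P) hφ]
    refine integral_congr_ae ?_
    filter_upwards [ιE_ae hL P] with y hy
    rw [hy, hPv]
  refine ⟨P, hPv, hPd, fun F' => ?_⟩
  intro φ φ₁ hφ
  have hcore := linForm_sub_pop_eq_of_strong hL lam a hΩ₁ hdm hVm hd hV hv2 hvw0 hvw1 hstrong hPint hφ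
  rw [hPdata hφ, hιdata hφ] at hcore
  have h12 : (0 : ℝ) ≤ 1 / 2 := by norm_num
  -- read-backs of the data of the statement
  have hfst : (WithLp.toLp 2 (P, (0 : Esp L hL))).fst = P := rfl
  have hsnd : (WithLp.toLp 2 (P, (0 : Esp L hL))).snd = 0 := rfl
  have hre : reW L (ofPair L (WithLp.toLp 2 (F' P - ιE hL P, (0 : W L)))) = F' P - ιE hL P := by
    rw [← (toPair_fst_snd _).1, toPair_ofPair]; rfl
  have him : imW L (ofPair L (WithLp.toLp 2 (F' P - ιE hL P, (0 : W L)))) = 0 := by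
    rw [← (toPair_fst_snd _).2, toPair_ofPair]; rfl
  have hlinP : linForm L (drift a Ω) (potential L lam Ω) (prim (der P)) (der P) φ φ₁ =
      linForm L (drift a Ω) (potential L lam Ω) v (deriv v) φ φ₁ :=
    linForm_congr_ae L _ _ (Eventually.of_forall fun y => congrFun hPv y) hPd
  have hlin0 : linForm L (drift a Ω) (potential L lam Ω) (prim (der (0 : Esp L hL))) (der (0 : Esp L hL)) φ φ₁ = 0 := by
    have h := (Eform_apply hL hdm hVm h12 hd hV (0 : Esp L hL) ⟨(φ, φ₁), hφ⟩).symm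
    rw [map_zero, LinearMap.zero_apply] at h
    exact h
  rw [hfst, hsnd, hre, him]
  refine ⟨?_, ?_⟩
  · rw [hlinP, integral_weight_mul_eq_Pdata hL ((-PopC hL lam a hc + F') P) hφ,
      integral_weight_mul_eq_Pdata hL (F' P - ιE hL P) hφ, _root_.add_apply, _root_.neg_apply,
      map_add (Pdata hL), map_neg (Pdata hL), map_sub (Pdata hL), LinearMap.add_apply, LinearMap.neg_apply,
      LinearMap.sub_apply]
    linarith
  · rw [hlin0, map_zero, integral_weight_mul_eq_Pdata hL (0 : W L) hφ, map_zero, LinearMap.zero_apply]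
    simp

/-- **Non-triviality.** If moreover `Ω X₀ ≠ 0` for some `X₀`, the element `P` above is non-zero (`timeShiftMode_ne_zero`: `v ≢ 0`). [folklore] -/
theorem esp_ne_zero_of_timeShiftMode (hL : 0 < L) {Ω v : ℝ → ℝ} (hΩ : ContDiff ℝ 1 Ω)
    (hv : v = fun ξ => Ω ξ + 1 / 2 * ξ * deriv Ω ξ) {X₀ : ℝ} (hX₀ : Ω X₀ ≠ 0) {P : Esp L hL} (hP : prim (der P) = v) :
    P ≠ 0 := by
  obtain ⟨X, hX⟩ := SheetRTimeShiftModeAssembly.timeShiftMode_ne_zero hΩ hv hX₀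
  exact esp_ne_zero_of_apply_ne_zero hL hP hX

/-- **(P6) TRANSPORTED, from the weak zero of record** (`ν = 1`, frame `L`, model parameter `a`, any `λ`): for an E-weak zero
`Ω = ∫₀Ω₁` (odd, finite weights, the profile equation against every `C_c^∞` test) there are a centre datum `hc : IsCentre L Ω Ω₁ H₀` and
`P ∈ Esp L hL` with `prim (der P) = Ω + ½ξΩ′`, `P ≠ 0` as soon as `Ω X₀ ≠ 0`, such that `(P, 0)` is a weak image datum
`IsWeakImage hL (−PopC + F′) (drift a Ω) (potential L λ Ω) (P, 0) (ofPair (F′P − ιE P, 0))` for every bounded `F′` — the (P6) hypothesis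
of the S2 kernel assembly for the data of record, up to the instantiation's `F′ = θℓ(·)f`. MODEL statement; not NS. [folklore] -/
theorem timeShiftMode_isWeakImage_of_weakZero {a : ℝ} (hL : 0 < L) (lam : ℝ) {Ω Ω₁ : ℝ → ℝ}
    (hΩ : ∀ x, Ω x = ∫ s in (0 : ℝ)..x, Ω₁ s) (hodd : ∀ y, Ω (-y) = -Ω y)
    (hΩ₁m : AEStronglyMeasurable Ω₁ volume)
    (hwΩ : Integrable fun y => (L ^ 2 + y ^ 2) * Ω y ^ 2) (hwΩ₁ : Integrable fun y => (L ^ 2 + y ^ 2) * Ω₁ y ^ 2)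
    (hweak : ∀ ψ : ℝ → ℝ, ContDiff ℝ ∞ ψ → HasCompactSupport ψ →
      (∫ x, (Ω x + 1 / 2 * x * Ω₁ x + a * (∫ s in (0 : ℝ)..x, hilbertTransform Ω s) * Ω₁ x
        - hilbertTransform Ω x * Ω x) * ψ x) + ∫ x, Ω₁ x * deriv ψ x = 0) :
    ∃ (H₀ : ℝ) (hc : IsCentre L Ω Ω₁ H₀) (P : Esp L hL),
      prim (der P) = (fun ξ => Ω ξ + 1 / 2 * ξ * deriv Ω ξ) ∧ (∀ X₀, Ω X₀ ≠ 0 → P ≠ 0) ∧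
      ∀ F' : Esp L hL →L[ℝ] W L,
        IsWeakImage hL (-PopC hL lam a hc + F') (drift a Ω) (potential L lam Ω)
          (WithLp.toLp 2 (P, (0 : Esp L hL))) (ofPair L (WithLp.toLp 2 (F' P - ιE hL P, (0 : W L)))) := by
  have hweak' : ∀ ψ : ℝ → ℝ, ContDiff ℝ ∞ ψ → HasCompactSupport ψ →
      (∫ x, (Ω x + 1 / 2 * x * Ω₁ x + a * (∫ s in (0 : ℝ)..x, hilbertTransform Ω s) * Ω₁ x
        - hilbertTransform Ω x * Ω x) * ψ x) + 1 * ∫ x, Ω₁ x * deriv ψ x = 0 := fun ψ hψ hψc => by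
    rw [one_mul]; exact hweak ψ hψ hψc
  obtain ⟨⟨hΩ3, -⟩, hveq, hvodd, hvw0, hvw1⟩ :=
    SheetRTimeShiftModeAssembly.timeShiftMode_eigen_and_energy_of_weakZero (a := a) hL one_pos hΩ hodd hΩ₁m hwΩ hwΩ₁ hweak' rfl
  have hΩ2 : ContDiff ℝ 2 Ω := hΩ3.of_le (by norm_num)
  -- the energy datum transfers to `deriv Ω`, and `|HΩ| ≤ H₀`
  have hΩ₁2 : MemLp Ω₁ 2 volume := memLp_two_of_weighted_sq hL hΩ₁m hwΩ₁
  have hae : Ω₁ =ᵐ[volume] deriv Ω := by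
    filter_upwards [_root_.LocallyIntegrable.ae_hasDerivAt_integral (hΩ₁2.locallyIntegrable one_le_two)] with y hy
    have e : Ω = fun x => ∫ s in (0 : ℝ)..x, Ω₁ s := funext hΩ
    have h1 : HasDerivAt Ω (Ω₁ y) y := by rw [e]; exact hy 0
    exact h1.unique (((hΩ2.differentiable (by norm_num)) y).hasDerivAt)
  have hw1 : Integrable fun y => (L ^ 2 + y ^ 2) * deriv Ω y ^ 2 :=
    hwΩ₁.congr (hae.mono fun y hy => by simp only [hy])
  obtain ⟨-, H₀, -, -, hH, -⟩ := SheetRProfileRegularity.exists_bounds hL hΩ2 hodd hwΩ hw1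
  have hc : IsCentre L Ω Ω₁ H₀ := ⟨hΩ, hodd, hΩ₁m, hwΩ, hwΩ₁, hH⟩
  have hstrong : ∀ X, (Ω X + 1 / 2 * X * deriv Ω X) + 1 / 2 * X * deriv (fun ξ => Ω ξ + 1 / 2 * ξ * deriv Ω ξ) X
      + a * ((∫ s in (0 : ℝ)..X, hilbertTransform (fun ξ => Ω ξ + 1 / 2 * ξ * deriv Ω ξ) s) * deriv Ω X
        + (∫ s in (0 : ℝ)..X, hilbertTransform Ω s) * deriv (fun ξ => Ω ξ + 1 / 2 * ξ * deriv Ω ξ) X)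
      - hilbertTransform (fun ξ => Ω ξ + 1 / 2 * ξ * deriv Ω ξ) X * Ω X
      - hilbertTransform Ω X * (Ω X + 1 / 2 * X * deriv Ω X)
      - iteratedDeriv 2 (fun ξ => Ω ξ + 1 / 2 * ξ * deriv Ω ξ) X = -(Ω X + 1 / 2 * X * deriv Ω X) := fun X => by
    have h := hveq X
    rw [one_mul] at h
    exact h
  obtain ⟨P, hPv, -, hW⟩ := timeShiftMode_isWeakImage hL lam a hc hΩ3 rfl hvodd hvw0 hvw1 hstrong
  exact ⟨H₀, hc, P, hPv, fun X₀ hX₀ => esp_ne_zero_of_timeShiftMode hL (hΩ3.of_le (by norm_num)) rfl hX₀ hPv, hW⟩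

/-! ### §5 From the weak image datum to selfsim's `IsWeakEigen … 1 u` -/

/-- The pair embedding of `(P, 0)` is `(ιE P, 0)`. [folklore] -/
theorem ιpair_toLp_zero (hL : 0 < L) (P : Esp L hL) :
    ιpair hL (WithLp.toLp 2 (P, (0 : Esp L hL))) = WithLp.toLp 2 (ιE hL P, (0 : W L)) := by
  obtain ⟨h1, h2⟩ := ιpair_fst_snd hL (WithLp.toLp 2 (P, (0 : Esp L hL)))
  refine WithLp.ofLp_injective 2 (Prod.ext ?_ ?_)
  · show (ιpair hL (WithLp.toLp 2 (P, (0 : Esp L hL)))).fst = ιE hL P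
    rw [h1]; rfl
  · show (ιpair hL (WithLp.toLp 2 (P, (0 : Esp L hL)))).snd = 0
    rw [h2]; exact map_zero (ιE hL)

/-- **The complexified odd-class vector of an energy-space element**: `u := ιE P + 0·i ∈ L²_{w,odd}(ℂ)`, with `toPair u = ιpair (P, 0)`, and
`u ≠ 0` when `P ≠ 0`. [folklore] -/
theorem exists_wcodd_of_esp (hL : 0 < L) (P : Esp L hL) :
    ∃ u : Wcodd L, (u : Wc L) = ofPair L (ιpair hL (WithLp.toLp 2 (P, (0 : Esp L hL)))) ∧ (P ≠ 0 → u ≠ 0) := by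
  refine ⟨⟨ofPair L (ιpair hL (WithLp.toLp 2 (P, (0 : Esp L hL)))), ofPair_ιpair_mem_Wcodd hL _⟩, rfl, fun hP hu => hP ?_⟩
  have h0 : ofPair L (ιpair hL (WithLp.toLp 2 (P, (0 : Esp L hL)))) = 0 := congrArg Subtype.val hu
  rw [ιpair_toLp_zero] at h0
  have h1 : toPair L (ofPair L (WithLp.toLp 2 (ιE hL P, (0 : W L)))) = toPair L 0 := by rw [h0]
  rw [toPair_ofPair, map_zero] at h1
  have h2 : ιE hL P = 0 := by
    have := congrArg WithLp.ofLp h1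
    exact (Prod.ext_iff.1 this).1
  exact eq_zero_of_ιE_eq_zero hL h2

/-- **(P6) AS `IsWeakEigen`.** If `(P, 0)` is a weak image datum `IsWeakImage hL K d V (P, 0) (ofPair (F′P − ιE P, 0))` (§4), `u` is the
complexified odd-class vector of `P`, and the instantiation's rank-one data are COMPATIBLE with `F′` on `P` — `(θ·ℓ u)·f = F′P + 0·i` — then
`u` is a weak eigenvector of `A − θℓ(·)f` at `σ = 1` in the sense of `SheetREvansOdd.IsWeakEigen`: the (P6) hypothesis of
`SheetRSpectrumOddAssembly.weakEigen_iff_eq_one` / `weakEigen_one_simple`. [folklore] -/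
theorem isWeakEigen_of_isWeakImage (hL : 0 < L) {K : Esp L hL →L[ℝ] W L} {d V : ℝ → ℝ} {P : Esp L hL} {F' : Esp L hL →L[ℝ] W L}
    (hW : IsWeakImage hL K d V (WithLp.toLp 2 (P, (0 : Esp L hL))) (ofPair L (WithLp.toLp 2 (F' P - ιE hL P, (0 : W L)))))
    (ℓ : Wcodd L →L[ℂ] ℂ) (f : Wcodd L) (θ : ℂ) {u : Wcodd L}
    (hu : (u : Wc L) = ofPair L (ιpair hL (WithLp.toLp 2 (P, (0 : Esp L hL)))))
    (hcompat : (θ * ℓ u) • (f : Wc L) = ofPair L (WithLp.toLp 2 (F' P, (0 : W L)))) :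
    IsWeakEigen hL K d V ℓ f θ 1 u := by
  refine ⟨WithLp.toLp 2 (P, 0), by rw [hu, toPair_ofPair], ?_⟩
  have e : (θ * ℓ u) • (f : Wc L) - (1 : ℂ) • (u : Wc L) = ofPair L (WithLp.toLp 2 (F' P - ιE hL P, (0 : W L))) := by
    rw [hcompat, one_smul, hu, ιpair_toLp_zero, ← map_sub, ← WithLp.toLp_sub, Prod.mk_sub_mk, sub_zero]
  rw [e]
  exact hW

/-- **(P6) FOR THE DATA OF RECORD, in one sentence.** From the weak zero of record (hypotheses of `timeShiftMode_isWeakImage_of_weakZero`) with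
`Ω X₀ ≠ 0`: for every bounded `F′` there are a centre datum `hc`, an energy-space `P` (`prim (der P) = Ω + ½ξΩ′`) and `u ∈ L²_{w,odd}(ℂ)`,
`u ≠ 0`, `toPair u = ιpair (P, 0)`, such that for ALL `ℓ, f, θ` compatible with `F′` on `P` (`(θ·ℓ u)·f = F′P + 0·i`),
`IsWeakEigen hL (−PopC hL λ a hc + F′) (drift a Ω) (potential L λ Ω) ℓ f θ 1 u`. MODEL statement; not NS. [folklore] -/
theorem timeShiftMode_isWeakEigen_of_weakZero {a : ℝ} (hL : 0 < L) (lam : ℝ) {Ω Ω₁ : ℝ → ℝ}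
    (hΩ : ∀ x, Ω x = ∫ s in (0 : ℝ)..x, Ω₁ s) (hodd : ∀ y, Ω (-y) = -Ω y)
    (hΩ₁m : AEStronglyMeasurable Ω₁ volume)
    (hwΩ : Integrable fun y => (L ^ 2 + y ^ 2) * Ω y ^ 2) (hwΩ₁ : Integrable fun y => (L ^ 2 + y ^ 2) * Ω₁ y ^ 2)
    (hweak : ∀ ψ : ℝ → ℝ, ContDiff ℝ ∞ ψ → HasCompactSupport ψ →
      (∫ x, (Ω x + 1 / 2 * x * Ω₁ x + a * (∫ s in (0 : ℝ)..x, hilbertTransform Ω s) * Ω₁ x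
        - hilbertTransform Ω x * Ω x) * ψ x) + ∫ x, Ω₁ x * deriv ψ x = 0)
    {X₀ : ℝ} (hX₀ : Ω X₀ ≠ 0) :
    ∃ (H₀ : ℝ) (hc : IsCentre L Ω Ω₁ H₀) (P : Esp L hL) (u : Wcodd L),
      prim (der P) = (fun ξ => Ω ξ + 1 / 2 * ξ * deriv Ω ξ) ∧ u ≠ 0 ∧
      (u : Wc L) = ofPair L (ιpair hL (WithLp.toLp 2 (P, (0 : Esp L hL)))) ∧
      ∀ (F' : Esp L hL →L[ℝ] W L) (ℓ : Wcodd L →L[ℂ] ℂ) (f : Wcodd L) (θ : ℂ),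
        (θ * ℓ u) • (f : Wc L) = ofPair L (WithLp.toLp 2 (F' P, (0 : W L))) →
          IsWeakEigen hL (-PopC hL lam a hc + F') (drift a Ω) (potential L lam Ω) ℓ f θ 1 u := by
  obtain ⟨H₀, hc, P, hPv, hP0, hW⟩ := timeShiftMode_isWeakImage_of_weakZero hL lam hΩ hodd hΩ₁m hwΩ hwΩ₁ hweak
  obtain ⟨u, hu, hu0⟩ := exists_wcodd_of_esp hL P
  exact ⟨H₀, hc, P, u, hPv, hu0 (hP0 X₀ hX₀), hu, fun F' ℓ f θ hcompat => isWeakEigen_of_isWeakImage hL (hW F') ℓ f θ hu hcompat⟩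

end SheetRTimeShiftModeWeakEigen
end Summit.NavierStokesRegularity.OSWSelfSimilar

end
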